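import Summits.QuantumFields.YangMills.Theorems.FluctuationComparisonRegPrIntLS2BetaMlogMixedDifference
import Literature.MathematicalPhysics.QuantumFieldTheory.Balaban1983to89.MatrixLogLipschitz
import Literature.MathematicalPhysics.QuantumFieldTheory.Balaban1983to89.BlockAveragingExpMeanLog
import Literature.Analysis.SpecialFunctions.ExpFDeriv
import HarnessLib

/-!
# S2β · `hFlat` road, brick (iii-a♯) of UV3-NODE §57.8 (C) — THE MEMBER-MEAN LEMMA IN FLUCTUATION FORM: the hybrid junk
# `log(A·e^{ā}·B) − mean_i log(A·e^{a_i}·B)` (`ā = mean_i a_i`) is bounded by (context size) × (mean member FLUCTUATION `‖a_i − ā‖`),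
# hence VANISHES when the members coincide — the form the KEY LEMMA's assembly needs (✓(iii-a)∕(iii-a′) gave (third order) × mean member SIZE)

Cell `ym3-torus` (rung R3 = continuum `SU(2)` Yang–Mills on the three-torus — NOT d = 4, NOT infinite volume, NOT a mass gap, NOT Clay).
Width seat «width 8» `ym3-torus-px8` (gen 21), FREE px helper on crux `stmt-QuantumFields-20520`, count-neutral, DEFINITION-FREE.

WHY.  With `g(a) := log(A·eᵃ·B) − a` the LINEAR parts cancel exactly in the hybrid step (`Σ_i w_i a_i = ā`, `Σ w = 1`):
`log(A·e^{ā}·B) − Σ_i w_i log(A·e^{a_i}·B) = Σ_i w_i (g(ā) − g(a_i))`; `‖g‖ ≤ 4(‖A−1‖ + ‖B−1‖)` on the ball (Lipschitz logarithm, lit ✓`norm_mlog_sub_mlog_le`,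
`log eᵃ = a`), so ONE Schwarz step along `a_i → ā` (the method of ✓`…MlogMixedDifference`) gives `‖g(ā) − g(a_i)‖ ≤ 64(‖A−1‖+‖B−1‖)‖ā − a_i‖`.  In the level-`t` step of
the KEY LEMMA the member fluctuations are ribbon FLUXES of level `t − 1`, so this junk is `ε_t·‖f^{(t−1)}‖` with `ε_t ∝ σ_t` summable in `t` — chargeable; the
SIZE-linear forms ✓p814025∕✓p814285 stay true but are not what the assembly uses.
* §1 `norm_mlog_triple_sub_self_le` : `‖A−1‖ ≤ 1∕20`, `‖a‖ ≤ 7∕40`, `‖B−1‖ ≤ 1∕20` ⟹ `‖log(A·eᵃ·B) − a‖ ≤ 4·(‖A−1‖ + ‖B−1‖)`.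
* §2 ★ `norm_nonlin_sub_nonlin_le` : `‖a‖, ‖a′‖ ≤ 1∕20` ⟹ `‖(log(A eᵃ B) − a) − (log(A e^{a′} B) − a′)‖ ≤ 64·(‖A−1‖ + ‖B−1‖)·‖a − a′‖`.
* §3 ★★ `norm_mlog_ctx_expMean_sub_mean_le_fluct` (convex weights) and §4 ★★ `norm_mlog_ctx_ESU_sub_mean_le_fluct` (`SU(N)`, `dist1` clothes).

HONEST SCOPE.  Complex-analytic bookkeeping (Schwarz lemma) over the tree's series logarithm; constants admissible, not optimal; nothing of Bałaban's analysis; the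
KEY LEMMA, the recursion, `hFlat`, TUBE-REG∘, GAP♯∘, S2β, crux 20520 and `YM3TorusSU2` are NOT proved; no registered stub is closed; the Yang–Mills mass gap is NOT proved.
References: T. Bałaban, CMP **109** (1987) [Balaban1987RG1] ((0.4)–(0.8) p.253); W. Rossmann, *Lie Groups* (OUP 2002) §1.3 [Rossmann2002].
-/

set_option autoImplicit false

noncomputable section

open NormedSpace Metric Set Finset
open scoped Topology BigOperators Matrix.Norms.L2Operator

namespace Summit.QuantumFields.YangMills.Theorems.FluctuationComparisonRegPrIntLS2BetaEmlMemberFluctuation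

open Literature.Analysis.Calculus.ExpDifferential (norm_exp_sub_one_le_exp_norm_sub_one)
open Literature.Analysis.Complex (logOnePlus differentiableOn_logOnePlus_comp)
open Literature.Analysis.SpecialFunctions (ExpFDeriv.differentiable_exp)
open Literature.MathematicalPhysics.QuantumFieldTheory.Balaban1983to89
open Literature.MathematicalPhysics.QuantumFieldTheory.Balaban1983to89.MatrixLog (mlog mlog_def norm_mlog_le_div)
open Literature.MathematicalPhysics.QuantumFieldTheory.Balaban1983to89.MatrixLogLipschitz (norm_mlog_sub_mlog_le)
open Literature.MathematicalPhysics.QuantumFieldTheory.Balaban1983to89.B7BlockAvgLog (mlog_exp)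
open Literature.MathematicalPhysics.QuantumFieldTheory.Balaban1983to89.ExpMeanLog (eml eml_eq_exp ESU coe_ESU_of_small deltaSU)
open Summit.QuantumFields.YangMills.Theorems.FluctuationComparisonRegPrIntLS2BetaMlogMixedDifference
  (norm_triple_sub_one_le exp_two_fifths_sub_one_le_half)

/-! ## §1 The nonlinear part `g(a) = log(A·eᵃ·B) − a` is of the size of the context -/

section Banach

variable {𝔸 : Type*} [NormedRing 𝔸] [NormedAlgebra ℂ 𝔸] [CompleteSpace 𝔸] [NormOneClass 𝔸]

/-- Numerics: `e^{7∕40} ≤ 3∕2` and `7∕40 < log 2`. [folklore] -/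
theorem exp_seven_fortieths_le : Real.exp (7 / 40) ≤ 3 / 2 ∧ (7 / 40 : ℝ) < Real.log 2 := by
  have h1 : Real.exp (7 / 40) ≤ Real.exp (2 / 5) := Real.exp_le_exp.mpr (by norm_num)
  have h2 := exp_two_fifths_sub_one_le_half
  refine ⟨by linarith, ?_⟩
  rw [Real.lt_log_iff_exp_lt (by norm_num)]
  linarith

/-- **THE NONLINEAR PART IS CONTEXT-SIZED**: `‖A − 1‖ ≤ 1∕20`, `‖a‖ ≤ 7∕40`, `‖B − 1‖ ≤ 1∕20` ⟹ `‖log(A·eᵃ·B) − a‖ ≤ 4·(‖A − 1‖ + ‖B − 1‖)`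
(`a = log eᵃ`, Lipschitz logarithm on the `½`-ball, `‖A eᵃ B − eᵃ‖ ≤ ‖A−1‖‖eᵃ‖‖B‖ + ‖eᵃ‖‖B−1‖`). [folklore] -/
theorem norm_mlog_triple_sub_self_le {A a B : 𝔸} (hA : ‖A - 1‖ ≤ 1 / 20) (ha : ‖a‖ ≤ 7 / 40) (hB : ‖B - 1‖ ≤ 1 / 20) :
    ‖mlog (A * exp a * B) - a‖ ≤ 4 * (‖A - 1‖ + ‖B - 1‖) := by
  obtain ⟨hexp, hlog⟩ := exp_seven_fortieths_le
  have hword : ‖A * exp a * B - 1‖ ≤ 1 / 2 := by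
    have h := norm_triple_sub_one_le (α := 7 / 40) (β := 1 / 20) (hA.trans (by norm_num)) ha hB
    have : Real.exp (2 * (7 / 40) + 1 / 20) = Real.exp (2 / 5) := by norm_num
    linarith [exp_two_fifths_sub_one_le_half]
  have hea1 : ‖exp a - 1‖ ≤ 1 / 2 := by
    calc ‖exp a - 1‖ ≤ Real.exp ‖a‖ - 1 := norm_exp_sub_one_le_exp_norm_sub_one a
      _ ≤ Real.exp (7 / 40) - 1 := by gcongr
      _ ≤ 1 / 2 := by linarith
  have hea : ‖exp a‖ ≤ 3 / 2 := by
    calc ‖exp a‖ = ‖(exp a - 1) + 1‖ := by rw [sub_add_cancel]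
      _ ≤ ‖exp a - 1‖ + ‖(1 : 𝔸)‖ := norm_add_le _ _
      _ ≤ 3 / 2 := by rw [norm_one]; linarith
  have hmexp : mlog (exp a) = a := mlog_exp (ha.trans_lt hlog)
  have hlip := norm_mlog_sub_mlog_le (r := 1 / 2) (by norm_num) hword hea1
  rw [hmexp] at hlip
  have hBn : ‖B‖ ≤ 1 + 1 / 20 := by
    calc ‖B‖ = ‖(B - 1) + 1‖ := by rw [sub_add_cancel]
      _ ≤ ‖B - 1‖ + ‖(1 : 𝔸)‖ := norm_add_le _ _
      _ ≤ 1 + 1 / 20 := by rw [norm_one]; linarith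
  have hdiff : ‖A * exp a * B - exp a‖ ≤ (63 / 40) * (‖A - 1‖ + ‖B - 1‖) := by
    have e : A * exp a * B - exp a = (A - 1) * exp a * B + exp a * (B - 1) := by noncomm_ring
    rw [e]
    calc ‖(A - 1) * exp a * B + exp a * (B - 1)‖ ≤ ‖(A - 1) * exp a * B‖ + ‖exp a * (B - 1)‖ := norm_add_le _ _
      _ ≤ ‖A - 1‖ * ‖exp a‖ * ‖B‖ + ‖exp a‖ * ‖B - 1‖ :=
          add_le_add ((norm_mul_le _ _).trans (mul_le_mul_of_nonneg_right (norm_mul_le _ _) (norm_nonneg _))) (norm_mul_le _ _)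
      _ ≤ ‖A - 1‖ * (3 / 2) * (1 + 1 / 20) + (3 / 2) * ‖B - 1‖ := by
          gcongr
      _ ≤ (63 / 40) * (‖A - 1‖ + ‖B - 1‖) := by nlinarith [norm_nonneg (A - 1), norm_nonneg (B - 1)]
  have hσ0 : 0 ≤ ‖A - 1‖ + ‖B - 1‖ := by positivity
  calc ‖mlog (A * exp a * B) - a‖ ≤ ‖A * exp a * B - exp a‖ / (1 - 1 / 2) := hlip
    _ ≤ (63 / 40) * (‖A - 1‖ + ‖B - 1‖) / (1 - 1 / 2) := by gcongr
    _ = (63 / 20) * (‖A - 1‖ + ‖B - 1‖) := by ring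
    _ ≤ 4 * (‖A - 1‖ + ‖B - 1‖) := by nlinarith

/-! ## §2 One Schwarz step for the nonlinear part -/

/-- ★ **THE NONLINEAR PART IS CONTEXT-LIPSCHITZ-SMALL**: for `‖A − 1‖, ‖B − 1‖ ≤ 1∕20` and `‖a‖, ‖a′‖ ≤ 1∕20`,
`‖(log(A·eᵃ·B) − a) − (log(A·e^{a′}·B) − a′)‖ ≤ 64·(‖A − 1‖ + ‖B − 1‖)·‖a − a′‖` — Schwarz along `t ↦ a′ + t(a − a′)` on the disc `|t| < (1∕8)∕‖a − a′‖`,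
where `‖a_t‖ ≤ 7∕40` and §1 bounds the function by `4(‖A−1‖+‖B−1‖)`. [cite: Rossmann2002, §1.3 Theorem 1, remark after (5)] -/
theorem norm_nonlin_sub_nonlin_le {A a a' B : 𝔸} (hA : ‖A - 1‖ ≤ 1 / 20) (ha : ‖a‖ ≤ 1 / 20) (ha' : ‖a'‖ ≤ 1 / 20) (hB : ‖B - 1‖ ≤ 1 / 20) :
    ‖(mlog (A * exp a * B) - a) - (mlog (A * exp a' * B) - a')‖ ≤ 64 * (‖A - 1‖ + ‖B - 1‖) * ‖a - a'‖ := by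
  rcases eq_or_ne a a' with rfl | hne
  · simp
  have hd0 : 0 < ‖a - a'‖ := norm_pos_iff.mpr (sub_ne_zero.mpr hne)
  set R : ℝ := (1 / 8) / ‖a - a'‖ with hR
  have hR1 : 1 < R := by
    rw [hR, lt_div_iff₀ hd0]; linarith [norm_sub_le a a']
  set σ : ℝ := ‖A - 1‖ + ‖B - 1‖ with hσ
  set g : ℂ → 𝔸 := fun t => mlog (A * exp (a' + t • (a - a')) * B) - (a' + t • (a - a')) with hg
  have hmem : ∀ t ∈ ball (0 : ℂ) R, ‖a' + t • (a - a')‖ ≤ 7 / 40 := by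
    intro t ht
    rw [mem_ball_zero_iff] at ht
    have htle : ‖t‖ * ‖a - a'‖ ≤ 1 / 8 := by
      have := mul_le_mul_of_nonneg_right ht.le hd0.le
      rw [hR, div_mul_cancel₀ _ hd0.ne'] at this; exact this
    calc ‖a' + t • (a - a')‖ ≤ ‖a'‖ + ‖t • (a - a')‖ := norm_add_le _ _
      _ ≤ 7 / 40 := by rw [norm_smul]; linarith
  have hgle : ∀ t ∈ ball (0 : ℂ) R, ‖g t‖ ≤ 4 * σ := fun t ht => norm_mlog_triple_sub_self_le hA (hmem t ht) hB
  have hword : ∀ t ∈ ball (0 : ℂ) R, ‖A * exp (a' + t • (a - a')) * B - 1‖ < 1 := by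
    intro t ht
    have h := norm_triple_sub_one_le (α := 7 / 40) (β := 1 / 20) (hA.trans (by norm_num)) (hmem t ht) hB
    have : Real.exp (2 * (7 / 40) + 1 / 20) = Real.exp (2 / 5) := by norm_num
    linarith [exp_two_fifths_sub_one_le_half]
  have haff : Differentiable ℂ fun t : ℂ => a' + t • (a - a') := (differentiable_id.smul_const (a - a')).const_add a'
  have hexpd : Differentiable ℂ fun t : ℂ => exp (a' + t • (a - a')) := fun t =>
    (ExpFDeriv.differentiable_exp ℂ (𝔸 := 𝔸) _).comp t (haff t)
  have hdiff : DifferentiableOn ℂ g (ball (0 : ℂ) R) := by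
    have hu : Differentiable ℂ fun t : ℂ => A * exp (a' + t • (a - a')) * B - 1 := ((hexpd.const_mul A).mul_const B).sub_const 1
    have h := differentiableOn_logOnePlus_comp hu.differentiableOn hword
    have h' : DifferentiableOn ℂ (fun t : ℂ => mlog (A * exp (a' + t • (a - a')) * B)) (ball (0 : ℂ) R) :=
      h.congr fun t _ => by simp only [mlog_def]
    exact h'.sub haff.differentiableOn
  have hmaps : MapsTo g (ball (0 : ℂ) R) (closedBall (g 0) (8 * σ)) := by
    intro t ht
    rw [mem_closedBall, dist_eq_norm]
    have h0 : (0 : ℂ) ∈ ball (0 : ℂ) R := mem_ball_self (by linarith)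
    calc ‖g t - g 0‖ ≤ ‖g t‖ + ‖g 0‖ := norm_sub_le _ _
      _ ≤ 4 * σ + 4 * σ := add_le_add (hgle t ht) (hgle 0 h0)
      _ = 8 * σ := by ring
  have h1 : (1 : ℂ) ∈ ball (0 : ℂ) R := by simpa using hR1
  have hS := Complex.dist_le_div_mul_dist_of_mapsTo_ball hdiff hmaps h1
  rw [dist_eq_norm, dist_zero_right, norm_one, mul_one] at hS
  have hg1 : g 1 = mlog (A * exp a * B) - a := by simp [hg]
  have hg0 : g 0 = mlog (A * exp a' * B) - a' := by simp [hg]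
  rw [hg1, hg0] at hS
  refine hS.trans (le_of_eq ?_)
  rw [hR, div_div_eq_mul_div]; ring

/-! ## §3 The hybrid step in fluctuation form (convex weights) -/

/-- ★★ **MEMBER-MEAN, FLUCTUATION FORM**: convex weights `w_i ≥ 0`, `Σ_{i∈s} w_i = 1`, members `‖a_i‖ ≤ 1∕20`, context `‖A − 1‖, ‖B − 1‖ ≤ 1∕20`, `ā := Σ w_i•a_i`:
`‖log(A·e^{ā}·B) − Σ_i w_i•log(A·e^{a_i}·B)‖ ≤ 64·(‖A − 1‖ + ‖B − 1‖)·Σ_i w_i‖a_i − ā‖` — (context size) × (mean member FLUCTUATION); zero when the members coincide.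
[cite: Balaban1987RG1, (0.4)-(0.8) p.253] -/
theorem norm_mlog_ctx_expMean_sub_mean_le_fluct {ι : Type*} (s : Finset ι) {w : ι → ℝ} (hw0 : ∀ i ∈ s, 0 ≤ w i)
    (hw1 : ∑ i ∈ s, w i = 1) {a : ι → 𝔸} (ha : ∀ i ∈ s, ‖a i‖ ≤ 1 / 20) {A B : 𝔸} (hA : ‖A - 1‖ ≤ 1 / 20) (hB : ‖B - 1‖ ≤ 1 / 20) :
    ‖mlog (A * exp (∑ i ∈ s, w i • a i) * B) - ∑ i ∈ s, w i • mlog (A * exp (a i) * B)‖ ≤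
      64 * (‖A - 1‖ + ‖B - 1‖) * ∑ i ∈ s, w i * ‖a i - ∑ j ∈ s, w j • a j‖ := by
  set abar : 𝔸 := ∑ i ∈ s, w i • a i with habar
  have hab : ‖abar‖ ≤ 1 / 20 := by
    calc ‖abar‖ ≤ ∑ i ∈ s, ‖w i • a i‖ := norm_sum_le _ _
      _ ≤ ∑ i ∈ s, w i * (1 / 20) := Finset.sum_le_sum fun i hi => by
          rw [norm_smul, Real.norm_of_nonneg (hw0 i hi)]; exact mul_le_mul_of_nonneg_left (ha i hi) (hw0 i hi)
      _ = 1 / 20 := by rw [← Finset.sum_mul, hw1, one_mul]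
  -- the linear parts cancel: the difference is `Σ w_i • (g ā − g a_i)`
  have e : mlog (A * exp abar * B) - ∑ i ∈ s, w i • mlog (A * exp (a i) * B) =
      ∑ i ∈ s, w i • ((mlog (A * exp abar * B) - abar) - (mlog (A * exp (a i) * B) - a i)) := by
    have h1 : ∑ i ∈ s, w i • ((mlog (A * exp abar * B) - abar) - (mlog (A * exp (a i) * B) - a i)) =
        (∑ i ∈ s, w i) • (mlog (A * exp abar * B) - abar) - (∑ i ∈ s, w i • mlog (A * exp (a i) * B) - ∑ i ∈ s, w i • a i) := by
      simp only [smul_sub, Finset.sum_sub_distrib, Finset.sum_smul]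
    rw [h1, hw1, one_smul, ← habar]
    abel
  rw [e]
  calc ‖∑ i ∈ s, w i • ((mlog (A * exp abar * B) - abar) - (mlog (A * exp (a i) * B) - a i))‖
      ≤ ∑ i ∈ s, ‖w i • ((mlog (A * exp abar * B) - abar) - (mlog (A * exp (a i) * B) - a i))‖ := norm_sum_le _ _
    _ ≤ ∑ i ∈ s, w i * (64 * (‖A - 1‖ + ‖B - 1‖) * ‖abar - a i‖) := Finset.sum_le_sum fun i hi => by
        rw [norm_smul, Real.norm_of_nonneg (hw0 i hi)]
        exact mul_le_mul_of_nonneg_left (norm_nonlin_sub_nonlin_le hA hab (ha i hi) hB) (hw0 i hi)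
    _ = 64 * (‖A - 1‖ + ‖B - 1‖) * ∑ i ∈ s, w i * ‖a i - abar‖ := by
        rw [Finset.mul_sum]
        exact Finset.sum_congr rfl fun i _ => by rw [norm_sub_rev abar (a i)]; ring

end Banach

/-! ## §4 `SU(N)` clothes -/

section SUN

variable {n : Type*} [Fintype n] [DecidableEq n] [Nonempty n]
variable {ι : Type*} [Fintype ι] [Nonempty ι]

/-- ★★ **MEMBER-MEAN IN AN `SU(N)` CONTEXT, FLUCTUATION FORM**: `W : ι → SU(N)`, `dist1 (W i) ≤ ρ ≤ 1∕41`, `ρ < δ_N`; context matrices `‖A − 1‖, ‖B − 1‖ ≤ 1∕20`;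
`a_i := log W_i`, `ā := |I|⁻¹Σ a_i` (so `ESU W = e^{ā}`):
`‖log(A·ESU W·B) − |I|⁻¹Σ_i log(A·W_i·B)‖ ≤ 64·(‖A − 1‖ + ‖B − 1‖)·|I|⁻¹Σ_i ‖a_i − ā‖` — the hybrid step of UV3-NODE §57.8 (C) at the cost (context size) ×
(mean member fluctuation) = small × flux. [cite: Balaban1987RG1, (0.4)-(0.8) p.253] -/
theorem norm_mlog_ctx_ESU_sub_mean_le_fluct (W : ι → Matrix.specialUnitaryGroup n ℂ) (A B : Matrix n n ℂ)
    {ρ : ℝ} (hρ : ρ < deltaSU n) (hρ41 : ρ ≤ 1 / 41) (hW : ∀ i, dist1 (W i) ≤ ρ)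
    (hA : ‖A - 1‖ ≤ 1 / 20) (hB : ‖B - 1‖ ≤ 1 / 20) :
    ‖mlog (A * ((ESU W : Matrix.specialUnitaryGroup n ℂ) : Matrix n n ℂ) * B) -
        ((Fintype.card ι : ℝ))⁻¹ • ∑ i, mlog (A * (W i : Matrix n n ℂ) * B)‖
      ≤ 64 * (‖A - 1‖ + ‖B - 1‖) *
          (((Fintype.card ι : ℝ))⁻¹ * ∑ i, ‖mlog (W i : Matrix n n ℂ) - ((Fintype.card ι : ℝ))⁻¹ • ∑ j, mlog (W j : Matrix n n ℂ)‖) := by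
  have hρ0 : 0 ≤ ρ := (GaugeGroup.dist1_nonneg _).trans (hW (Classical.arbitrary ι))
  have hWn : ∀ i, ‖(W i : Matrix n n ℂ) - 1‖ ≤ ρ := fun i => hW i
  set a : ι → Matrix n n ℂ := fun i => mlog (W i : Matrix n n ℂ) with hadef
  have ha : ∀ i ∈ (Finset.univ : Finset ι), ‖a i‖ ≤ 1 / 20 := fun i _ => by
    have h1 : ‖(W i : Matrix n n ℂ) - 1‖ < 1 := (hWn i).trans_lt (by linarith)
    refine (norm_mlog_le_div h1).trans ?_
    rw [div_le_iff₀ (by linarith)]; nlinarith [hWn i, norm_nonneg ((W i : Matrix n n ℂ) - 1)]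
  have hexpW : ∀ i, exp (a i) = (W i : Matrix n n ℂ) := fun i => MatrixLog.exp_mlog ((hWn i).trans_lt (by linarith))
  have hguard : ∀ i, ‖(W i : Matrix n n ℂ) - 1‖ < deltaSU n := fun i => (hWn i).trans_lt hρ
  have hc : (0 : ℝ) < Fintype.card ι := Nat.cast_pos.mpr Fintype.card_pos
  have hcoe : ((Fintype.card ι : ℂ))⁻¹ = ((((Fintype.card ι : ℝ))⁻¹ : ℝ) : ℂ) := by
    rw [Complex.ofReal_inv, Complex.ofReal_natCast]
  have hESU : ((ESU W : Matrix.specialUnitaryGroup n ℂ) : Matrix n n ℂ) = exp (∑ i, ((Fintype.card ι : ℝ))⁻¹ • a i) := by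
    rw [coe_ESU_of_small hguard, eml_eq_exp, hcoe, Complex.coe_smul, Finset.smul_sum]
  have hmain := norm_mlog_ctx_expMean_sub_mean_le_fluct (𝔸 := Matrix n n ℂ) Finset.univ (w := fun _ : ι => ((Fintype.card ι : ℝ))⁻¹)
    (fun _ _ => inv_nonneg.mpr hc.le) (by rw [Finset.sum_const, Finset.card_univ, nsmul_eq_mul, mul_inv_cancel₀ hc.ne'])
    (a := a) ha hA hB
  have h2 : ∑ i, ((Fintype.card ι : ℝ))⁻¹ • mlog (A * exp (a i) * B) =
      ((Fintype.card ι : ℝ))⁻¹ • ∑ i, mlog (A * (W i : Matrix n n ℂ) * B) := by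
    rw [Finset.smul_sum]
    exact Finset.sum_congr rfl fun i _ => by rw [hexpW i]
  have h3 : ∀ i, ‖a i - ∑ j, ((Fintype.card ι : ℝ))⁻¹ • a j‖ = ‖a i - ((Fintype.card ι : ℝ))⁻¹ • ∑ j, a j‖ := fun i => by
    rw [Finset.smul_sum]
  simp only [h2, h3] at hmain
  rw [← Finset.mul_sum] at hmain
  rw [hESU]
  exact hmain

end SUN

end Summit.QuantumFields.YangMills.Theorems.FluctuationComparisonRegPrIntLS2BetaEmlMemberFluctuation

end
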